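import Literature.Analysis.FunctionSpaces.TorusSobolevNorm
import Literature.Analysis.FunctionSpaces.TorusSobolevNormProofs
import Literature.Analysis.FunctionSpaces.TorusSobolevNormSmoothProofs
import Literature.Analysis.FunctionSpaces.TorusFourierCalculus
import Literature.Analysis.FunctionSpaces.TorusFourierSynthesis
import Literature.Analysis.FunctionSpaces.TorusSpectralWeakDerivative
import Literature.Analysis.FunctionSpaces.TorusTestFunction
import HarnessLib

/-!
# `H^{k+1}(T^d) = {f ∈ H^k : ∂ᵢf ∈ H^k weakly}`: discharge of `Torus.memSobolev_nat_iff_hasWeakPartialDeriv`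

Discharge of the named fact `Literature.Analysis.FunctionSpaces.Torus.memSobolev_nat_iff_hasWeakPartialDeriv`
of `TorusSobolevNorm` (complete inner-product target `F`):

* `Torus.memSobolev_nat_iff_hasWeakPartialDeriv_holds` — for `k ∈ ℕ` and `f : T^d → F`,
  `f ∈ H^{k+1}` iff `f ∈ H^k` and, for every axis `i`, `f` has a weak `i`-th partial derivative
  (`Torus.HasWeakPartialDeriv`, Evans 2010, §5.2.1) lying in `H^k`.

This is the torus analogue of Evans 2010, §5.8, Thm. 8 ("Characterization of `H^k` by Fourier
transform": `u ∈ H^k(ℝⁿ)` iff `(1 + |y|^k) û ∈ L²`), and the proof follows Evans's two steps with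
Fourier series in place of the Fourier transform (Grafakos 2014, Prop. 3.1.2 (10):
`𝓕(∂ⱼφ)(m) = 2πi mⱼ φ̂(m)`; Prop. 3.2.4: uniqueness of coefficients in `L¹`; Prop. 3.2.7 (4):
Riesz–Fischer):

1. (Evans, step 2 of the proof: `u_α := ((iy)^α û)ˇ` is the weak derivative, checked against test
   functions through Plancherel.) `Torus.hasSum_mFourierCoeff_smul_mFourierCoeff_neg` — the pairing
   formula `∫ Φ • f = ∑ₙ Φ̂(n) • f̂(-n)` for smooth `Φ : T^d → ℂ` and integrable `f` (the smooth
   test function is the uniformly convergent sum of its Fourier series,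
   `Torus.IsSmooth.fourierSynth_mFourierCoeff`, and the integral is exchanged with the absolutely
   convergent sum); hence `Torus.hasWeakPartialDeriv_of_forall_mFourierCoeff_eq`: an integrable `g`
   with `ĝ(n) = 2πi nᵢ f̂(n)` is a weak `i`-th derivative of `f`. With Riesz–Fischer in `L²(T^d; F)`
   (`Torus.exists_memLp_two_forall_mFourierCoeff_eq_of_summable`) this gives `H^{k+1} → ∂ᵢf ∈ H^k`.
2. (Evans, step 1: `(D^α u)^ = (iy)^α û` for `u ∈ H^k`.) `Torus.mFourierCoeff_eq_of_hasWeakPartialDeriv`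
   — if `g` is a weak `i`-th derivative of `f` (both integrable) then `ĝ(n) = 2πi nᵢ f̂(n)`, by
   testing the weak identity with the smooth real functions `Re e_{-n}`, `Im e_{-n}` and
   `∂ᵢ e_{-n} = -2πi nᵢ e_{-n}` (`Torus.partialDeriv_mFourier`); on the torus no approximation
   argument is needed since the characters are themselves admissible test functions.
3. The weight algebra `⟨n⟩^{2(k+1)} = ⟨n⟩^{2k} (1 + ∑ᵢ nᵢ²)`
   (`Torus.ofReal_sobolevWeight_natCast_succ_sq`) turns `∑ₙ ⟨n⟩^{2(k+1)} ‖f̂(n)‖² < ∞` into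
   `∑ₙ ⟨n⟩^{2k} ‖f̂(n)‖² < ∞ ∧ ∀ i, ∑ₙ ⟨n⟩^{2k} ‖2πi nᵢ f̂(n)‖² < ∞` and back (`1 ≤ 4π²`).

The vector-valued setting costs nothing: steps 1–2 hold for any complex Banach target; the Hilbert
structure enters only through Riesz–Fischer (`TorusSobolevNormProofs`). Not here: fractional or
negative orders, and the norm equivalence of Evans's Thm. 8 (ii) (only membership is stated by the
fact).

## References

* L. C. Evans, *Partial Differential Equations*, 2nd ed., GSM 19 (AMS 2010), §5.2.1 (weak
  derivatives), §5.8 Thm. 8 (characterization of `H^k` by the Fourier transform). [Evans2010]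
* L. Grafakos, *Classical Fourier Analysis*, 3rd ed., GTM 249 (Springer 2014), Prop. 3.1.2 (10),
  Prop. 3.2.4, Prop. 3.2.5, Prop. 3.2.7 (PDF pp. 188, 194–196). [Grafakos2014]
-/

open MeasureTheory Set Filter Topology UnitAddTorus
open scoped ENNReal NNReal

noncomputable section

namespace Literature.Analysis.FunctionSpaces

namespace Torus

variable {d : Type*} [Fintype d]

/-! ## Pairing integrable functions with smooth test functions -/

section Pairing

variable {F : Type*} [NormedAddCommGroup F] [NormedSpace ℂ F]

/-- **Pairing through Fourier coefficients**: for smooth `Φ : T^d → ℂ` and integrable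
`f : T^d → F` (complex normed target), `∫ Φ • f = ∑ₙ Φ̂(n) • f̂(-n)` as a `HasSum`. Proof: `Φ` is
the sum of its absolutely convergent Fourier series (Grafakos 2014, Prop. 3.2.5 with Thm. 3.3.9;
`Torus.IsSmooth.fourierSynth_mFourierCoeff`), and `∑ₙ ∫ ‖(e_n Φ̂(n)) • f‖ = (∑ₙ |Φ̂(n)|) ‖f‖₁ < ∞`
allows the exchange of sum and integral; `∫ e_n • f = f̂(-n)`. [cite: Grafakos2014, Prop. 3.2.5] -/
theorem hasSum_mFourierCoeff_smul_mFourierCoeff_neg {Φ : UnitAddTorus d → ℂ} (hΦ : IsSmooth Φ)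
    {f : UnitAddTorus d → F} (hf : Integrable f volume) :
    HasSum (fun n : d → ℤ => mFourierCoeff Φ n • mFourierCoeff f (-n)) (∫ x, Φ x • f x) := by
  classical
  -- the coefficients of `Φ` decay rapidly and `Φ` is the sum of its Fourier series
  have hc : RapidDecay (mFourierCoeff Φ) := hΦ.rapidDecay_mFourierCoeff
  have hcs : Summable fun n => ‖mFourierCoeff Φ n‖ := hc.summable_norm
  have hsyn : ∀ x, HasSum (fun n => mFourier n x • mFourierCoeff Φ n) (Φ x) := fun x => by
    have h := hc.hasSum_fourierSynth x
    rwa [hΦ.fourierSynth_mFourierCoeff] at h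
  -- the terms `(e_n(x) Φ̂(n)) • f x`: integrable, with summable `L¹` norms
  have hint : ∀ n : d → ℤ,
      Integrable (fun x => (mFourier n x * mFourierCoeff Φ n) • f x) volume := fun n =>
    hf.bdd_smul ‖mFourierCoeff Φ n‖ ((mFourier n).continuous.mul continuous_const).aestronglyMeasurable
      (ae_of_all _ fun x => by rw [norm_mul, norm_mFourier_apply, one_mul])
  have hnorm : ∀ (n : d → ℤ) (x : UnitAddTorus d),
      ‖(mFourier n x * mFourierCoeff Φ n) • f x‖ = ‖mFourierCoeff Φ n‖ * ‖f x‖ := fun n x => by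
    rw [norm_smul, norm_mul, norm_mFourier_apply, one_mul]
  have hsum : Summable fun n : d → ℤ => ∫ x, ‖(mFourier n x * mFourierCoeff Φ n) • f x‖ := by
    refine (hcs.mul_right (∫ x, ‖f x‖)).congr fun n => ?_
    simp_rw [hnorm]
    rw [integral_const_mul]
  have H := hasSum_integral_of_summable_integral_norm hint hsum
  -- identify the terms: `∫ (e_n Φ̂(n)) • f = Φ̂(n) • f̂(-n)`
  have hterm : ∀ n : d → ℤ, ∫ x, (mFourier n x * mFourierCoeff Φ n) • f x =
      mFourierCoeff Φ n • mFourierCoeff f (-n) := fun n => by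
    rw [mFourierCoeff_eq_integral_volume f (-n), neg_neg, ← integral_smul]
    refine integral_congr_ae (ae_of_all _ fun x => ?_)
    simp only [smul_smul]
    rw [mul_comm]
  -- identify the sum: `∑ₙ (e_n(x) Φ̂(n)) • f x = Φ x • f x`
  have hval : ∀ x, ∑' n : d → ℤ, (mFourier n x * mFourierCoeff Φ n) • f x = Φ x • f x := fun x =>
    ((hsyn x).smul_const (f x)).tsum_eq
  simp only [hterm, hval] at H
  exact H

end Pairing

/-! ## Fourier coefficients of weak derivatives, and conversely -/

section WeakDeriv

variable [DecidableEq d]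
variable {F : Type*} [NormedAddCommGroup F] [NormedSpace ℂ F]

omit [DecidableEq d] in
/-- Splitting a complex-weighted integral into real and imaginary parts:
`∫ ψ • h = ∫ (Re ψ) • h + i ∫ (Im ψ) • h` for smooth `ψ : T^d → ℂ` and integrable `h` (the real
scalar action being the restriction of the complex one). [folklore] -/
theorem integral_smul_eq_re_add_I_smul_im {ψ : UnitAddTorus d → ℂ} (hψ : IsSmooth ψ)
    {h : UnitAddTorus d → F} (hh : Integrable h volume) :
    ∫ x, ψ x • h x = (∫ x, (ψ x).re • h x) + Complex.I • ∫ x, (ψ x).im • h x := by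
  have hre : IsSmooth fun x => (ψ x).re := hψ.comp_clm Complex.reCLM
  have him : IsSmooth fun x => (ψ x).im := hψ.comp_clm Complex.imCLM
  have h2i : Integrable (fun x => Complex.I • ((ψ x).im • h x)) volume :=
    (him.integrable_smul hh).smul Complex.I
  rw [← integral_smul, ← integral_add (hre.integrable_smul hh) h2i]
  refine integral_congr_ae (ae_of_all _ fun x => ?_)
  beta_reduce
  calc ψ x • h x = (((ψ x).re : ℂ) + ((ψ x).im : ℂ) * Complex.I) • h x := by rw [Complex.re_add_im]
    _ = ((ψ x).re : ℂ) • h x + Complex.I • (((ψ x).im : ℂ) • h x) := by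
        rw [add_smul, mul_comm, mul_smul]
    _ = (ψ x).re • h x + Complex.I • ((ψ x).im • h x) := by
        rw [Complex.coe_smul, Complex.coe_smul]

/-- **Fourier coefficients of a weak derivative** (torus form of step 1 of the proof of
Evans 2010, §5.8 Thm. 8: `(D^α u)^ = (iy)^α û`): if `g` is a weak `i`-th partial derivative of `f`
on `T^d` (both integrable, values in a complex normed space), then `ĝ(n) = 2πi nᵢ f̂(n)` for every
`n ∈ ℤ^d`. Test the weak identity `∫ ∂ᵢφ • f = -∫ φ • g` with the smooth real functions
`φ = Re e_{-n}`, `Im e_{-n}`, recombine with `∫ ψ • h = ∫ Re ψ • h + i ∫ Im ψ • h`, and use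
`∂ᵢ e_{-n} = -2πi nᵢ e_{-n}` (Grafakos 2014, Prop. 3.1.2 (10)).
[cite: Evans2010, §5.8 Thm. 8 (Characterization of H^k by Fourier transform) proof step 1] -/
theorem mFourierCoeff_eq_of_hasWeakPartialDeriv {i : d} {f g : UnitAddTorus d → F}
    (hf : Integrable f volume) (hg : Integrable g volume) (h : HasWeakPartialDeriv i f g)
    (n : d → ℤ) :
    mFourierCoeff g n = (2 * Real.pi * Complex.I * (n i)) • mFourierCoeff f n := by
  have hχ : IsSmooth (⇑(mFourier (-n)) : UnitAddTorus d → ℂ) := isSmooth_mFourier (-n)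
  have hre : IsSmooth fun y => (mFourier (-n) y).re := hχ.comp_clm Complex.reCLM
  have him : IsSmooth fun y => (mFourier (-n) y).im := hχ.comp_clm Complex.imCLM
  set c : ℂ := 2 * Real.pi * Complex.I * ((-n) i) with hc
  have hcχ : IsSmooth (fun x => c * mFourier (-n) x) := contDiff_const.mul hχ
  -- derivatives of the real and imaginary parts of the character `e_{-n}`
  have hdre : ∀ x, partialDeriv i (fun y => (mFourier (-n) y).re) x = (c * mFourier (-n) x).re :=
    fun x => by
    have h1 := partialDeriv_clm_comp hχ Complex.reCLM i x
    rw [partialDeriv_mFourier] at h1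
    exact h1
  have hdim : ∀ x, partialDeriv i (fun y => (mFourier (-n) y).im) x = (c * mFourier (-n) x).im :=
    fun x => by
    have h1 := partialDeriv_clm_comp hχ Complex.imCLM i x
    rw [partialDeriv_mFourier] at h1
    exact h1
  -- the weak identity tested with `Re e_{-n}` and `Im e_{-n}`
  have h1 := h (fun y => (mFourier (-n) y).re) hre
  have h2 := h (fun y => (mFourier (-n) y).im) him
  beta_reduce at h1 h2
  simp_rw [hdre] at h1
  simp_rw [hdim] at h2
  have h1' : ∫ x, (mFourier (-n) x).re • g x = -∫ x, (c * mFourier (-n) x).re • f x := by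
    rw [h1, neg_neg]
  have h2' : ∫ x, (mFourier (-n) x).im • g x = -∫ x, (c * mFourier (-n) x).im • f x := by
    rw [h2, neg_neg]
  calc mFourierCoeff g n = ∫ x, mFourier (-n) x • g x := mFourierCoeff_eq_integral_volume g n
    _ = (∫ x, (mFourier (-n) x).re • g x) + Complex.I • ∫ x, (mFourier (-n) x).im • g x :=
        integral_smul_eq_re_add_I_smul_im hχ hg
    _ = -((∫ x, (c * mFourier (-n) x).re • f x) +
          Complex.I • ∫ x, (c * mFourier (-n) x).im • f x) := by
        rw [h1', h2', smul_neg, neg_add]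
    _ = -∫ x, (c * mFourier (-n) x) • f x := by rw [integral_smul_eq_re_add_I_smul_im hcχ hf]
    _ = -(c • mFourierCoeff f n) := by
        rw [mFourierCoeff_eq_integral_volume, ← integral_smul]
        congr 1
        refine integral_congr_ae (ae_of_all _ fun x => ?_)
        simp only [smul_smul]
    _ = (2 * Real.pi * Complex.I * (n i)) • mFourierCoeff f n := by
        rw [← neg_smul]
        congr 1
        simp only [hc, Pi.neg_apply, Int.cast_neg]
        ring

/-- **A function with the coefficients of a derivative is a weak derivative** (torus form of
step 2 of the proof of Evans 2010, §5.8 Thm. 8: `u_α := ((iy)^α û)ˇ` satisfies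
`∫ D^αφ u = (-1)^{|α|} ∫ φ u_α`): if `f, g` are integrable on `T^d` with `ĝ(n) = 2πi nᵢ f̂(n)` for
all `n`, then `g` is a weak `i`-th partial derivative of `f`. For smooth real `φ`, both
`∫ ∂ᵢφ • f` and `-∫ φ • g` equal `∑ₙ 2πi nᵢ φ̂(n) • f̂(-n)` by the pairing formula
`Torus.hasSum_mFourierCoeff_smul_mFourierCoeff_neg` and `𝓕(∂ᵢφ)(n) = 2πi nᵢ φ̂(n)`
(Grafakos 2014, Prop. 3.1.2 (10); `Torus.mFourierCoeff_partialDeriv`).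
[cite: Evans2010, §5.8 Thm. 8 (Characterization of H^k by Fourier transform) proof step 2] -/
theorem hasWeakPartialDeriv_of_forall_mFourierCoeff_eq {i : d} {f g : UnitAddTorus d → F}
    (hf : Integrable f volume) (hg : Integrable g volume)
    (hcoeff : ∀ n : d → ℤ,
      mFourierCoeff g n = (2 * Real.pi * Complex.I * (n i)) • mFourierCoeff f n) :
    HasWeakPartialDeriv i f g := by
  intro φ hφ
  have hΦ : IsSmooth (fun x => (φ x : ℂ)) := hφ.ofReal_comp
  have hdΦ : IsSmooth (partialDeriv i fun x => (φ x : ℂ)) := hΦ.partialDeriv i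
  have h1 := hasSum_mFourierCoeff_smul_mFourierCoeff_neg hdΦ hf
  have h2 := (hasSum_mFourierCoeff_smul_mFourierCoeff_neg hΦ hg).neg
  have hv1 : ∫ x, partialDeriv i (fun y => (φ y : ℂ)) x • f x = ∫ x, partialDeriv i φ x • f x := by
    refine integral_congr_ae (ae_of_all _ fun x => ?_)
    simp only [partialDeriv_ofReal_comp hφ, Complex.coe_smul]
  have hv2 : ∫ x, (φ x : ℂ) • g x = ∫ x, φ x • g x :=
    integral_congr_ae (ae_of_all _ fun x => Complex.coe_smul _ _)
  rw [hv1] at h1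
  rw [hv2] at h2
  refine h1.unique (h2.congr_fun fun n => ?_)
  rw [mFourierCoeff_partialDeriv hΦ i n, hcoeff (-n), smul_smul, ← neg_smul]
  congr 1
  simp only [smul_eq_mul, Pi.neg_apply, Int.cast_neg]
  ring

end WeakDeriv

/-! ## Weight algebra -/

section Weights

variable {F : Type*} [NormedAddCommGroup F] [NormedSpace ℂ F]

/-- Finiteness of the `H^s` norm is finiteness of the weighted sum `∑ₙ ⟨n⟩^{2s} ‖f̂(n)‖²`. [folklore] -/
theorem eSobolevNorm_lt_top_iff {s : ℝ} {f : UnitAddTorus d → F} :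
    eSobolevNorm s f < ∞ ↔
      ∑' n : d → ℤ, ENNReal.ofReal (sobolevWeight s n ^ 2) * ‖mFourierCoeff f n‖ₑ ^ 2 < ∞ := by
  unfold eSobolevNorm
  exact ENNReal.rpow_lt_top_iff_of_pos (by norm_num)

/-- Weights of consecutive integer orders: `⟨n⟩^{2(k+1)} = ⟨n⟩^{2k} (1 + ∑ᵢ nᵢ²)` in `ℝ≥0∞`. [folklore] -/
theorem ofReal_sobolevWeight_natCast_succ_sq (k : ℕ) (n : d → ℤ) :
    ENNReal.ofReal (sobolevWeight ((k : ℝ) + 1) n ^ 2) =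
      ENNReal.ofReal (sobolevWeight (k : ℝ) n ^ 2) *
        (1 + ∑ i, ENNReal.ofReal ((n i : ℝ) ^ 2)) := by
  have hk : ((k : ℝ) + 1) = ((k + 1 : ℕ) : ℝ) := by push_cast; ring
  rw [hk, sobolevWeight_natCast_sq, sobolevWeight_natCast_sq, pow_succ,
    ENNReal.ofReal_mul (one_add_freqNormSq_pow_nonneg n k), freqNormSq,
    ENNReal.ofReal_add zero_le_one (Finset.sum_nonneg fun i _ => sq_nonneg _), ENNReal.ofReal_one,
    ENNReal.ofReal_sum_of_nonneg fun i _ => sq_nonneg _]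

/-- Weights of nonnegative integer order are at least one: `1 ≤ ⟨n⟩^{2k}`. [folklore] -/
theorem one_le_ofReal_sobolevWeight_natCast_sq (k : ℕ) (n : d → ℤ) :
    1 ≤ ENNReal.ofReal (sobolevWeight (k : ℝ) n ^ 2) := by
  rw [sobolevWeight_natCast_sq]
  exact ENNReal.one_le_ofReal.2 (one_le_pow₀ (one_le_one_add_freqNormSq n))

/-- `‖(2πi m) • a‖ₑ² = 4π² m² ‖a‖ₑ²` in `ℝ≥0∞`. [folklore] -/
theorem enorm_sq_two_pi_I_mul_smul (m : ℤ) (a : F) :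
    ‖(2 * Real.pi * Complex.I * (m : ℂ)) • a‖ₑ ^ 2 =
      ENNReal.ofReal (4 * Real.pi ^ 2) * ENNReal.ofReal ((m : ℝ) ^ 2) * ‖a‖ₑ ^ 2 := by
  rw [enorm_smul, mul_pow, enorm_sq_two_pi_I_mul]

end Weights

/-! ## The discharge -/

section Main

variable [DecidableEq d]
variable {F : Type*} [NormedAddCommGroup F] [InnerProductSpace ℂ F] [CompleteSpace F]

/-- Discharge of the named fact `Torus.memSobolev_nat_iff_hasWeakPartialDeriv`: **integer-order
Sobolev spaces on `T^d` via weak derivatives** — for `k ∈ ℕ` and a complete inner-product target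
`F`, `f ∈ H^{k+1}(T^d; F)` iff `f ∈ H^k` and every weak partial derivative `∂ᵢ f` exists in `H^k`
(torus analogue of Evans 2010, §5.8 Thm. 8, "Characterization of `H^k` by Fourier transform",
proved along Evans's two steps). `→`: `H^{k+1} ⊆ H^k`; the sequence `2πi nᵢ f̂(n)` is square
summable with weight `⟨n⟩^{2k}` (as `nᵢ² ⟨n⟩^{2k} ≤ ⟨n⟩^{2(k+1)}`), Riesz–Fischer
(Grafakos 2014, Prop. 3.2.7 (4); `Torus.exists_memLp_two_forall_mFourierCoeff_eq_of_summable`)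
gives `g ∈ L²` with these coefficients, and `g` is a weak `i`-th derivative by
`Torus.hasWeakPartialDeriv_of_forall_mFourierCoeff_eq`. `←`: the coefficients of the weak
derivatives are `2πi nᵢ f̂(n)` (`Torus.mFourierCoeff_eq_of_hasWeakPartialDeriv`), and
`⟨n⟩^{2(k+1)} ‖f̂(n)‖² ≤ ⟨n⟩^{2k} ‖f̂(n)‖² + ∑ᵢ ⟨n⟩^{2k} ‖ĝᵢ(n)‖²` (`1 ≤ 4π²`) sums to a finite
quantity. [cite: Evans2010, §5.8 Thm. 8 (Characterization of H^k by Fourier transform; torus analogue)] -/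
theorem memSobolev_nat_iff_hasWeakPartialDeriv_holds :
    memSobolev_nat_iff_hasWeakPartialDeriv (d := d) (F := F) := by
  intro k f
  constructor
  · -- `H^{k+1} ⊆ H^k`, and the weak derivatives are synthesised from `2πi nᵢ f̂(n)` (Riesz–Fischer)
    intro hf
    have hfk : MemSobolev (k : ℝ) f := hf.mono (by linarith)
    refine ⟨hfk, fun i => ?_⟩
    have hS := eSobolevNorm_lt_top_iff.1 hf.2
    -- the coefficients of the would-be derivative
    set a : (d → ℤ) → F := fun n => (2 * Real.pi * Complex.I * (n i)) • mFourierCoeff f n with ha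
    -- `⟨n⟩^{2k} ‖a n‖² ≤ 4π² ⟨n⟩^{2(k+1)} ‖f̂(n)‖²`
    have hle : ∀ n, ENNReal.ofReal (sobolevWeight (k : ℝ) n ^ 2) * ‖a n‖ₑ ^ 2 ≤
        ENNReal.ofReal (4 * Real.pi ^ 2) *
          (ENNReal.ofReal (sobolevWeight ((k : ℝ) + 1) n ^ 2) * ‖mFourierCoeff f n‖ₑ ^ 2) := by
      intro n
      rw [ha, enorm_sq_two_pi_I_mul_smul, ofReal_sobolevWeight_natCast_succ_sq]
      have hi : ENNReal.ofReal ((n i : ℝ) ^ 2) ≤ 1 + ∑ j, ENNReal.ofReal ((n j : ℝ) ^ 2) :=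
        le_add_left (Finset.single_le_sum (f := fun j => ENNReal.ofReal ((n j : ℝ) ^ 2))
          (fun j _ => zero_le) (Finset.mem_univ i))
      calc ENNReal.ofReal (sobolevWeight (k : ℝ) n ^ 2) *
            (ENNReal.ofReal (4 * Real.pi ^ 2) * ENNReal.ofReal ((n i : ℝ) ^ 2) *
              ‖mFourierCoeff f n‖ₑ ^ 2)
          = ENNReal.ofReal (4 * Real.pi ^ 2) *
            (ENNReal.ofReal (sobolevWeight (k : ℝ) n ^ 2) * ENNReal.ofReal ((n i : ℝ) ^ 2) *
              ‖mFourierCoeff f n‖ₑ ^ 2) := by ring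
        _ ≤ ENNReal.ofReal (4 * Real.pi ^ 2) *
            (ENNReal.ofReal (sobolevWeight (k : ℝ) n ^ 2) *
              (1 + ∑ j, ENNReal.ofReal ((n j : ℝ) ^ 2)) * ‖mFourierCoeff f n‖ₑ ^ 2) := by
          gcongr
    have hfin : ∑' n, ENNReal.ofReal (sobolevWeight (k : ℝ) n ^ 2) * ‖a n‖ₑ ^ 2 < ∞ := by
      refine lt_of_le_of_lt (ENNReal.tsum_le_tsum hle) ?_
      rw [ENNReal.tsum_mul_left]
      exact ENNReal.mul_lt_top ENNReal.ofReal_lt_top hS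
    -- in particular `a` is square summable: Riesz–Fischer gives `g ∈ L²` with `ĝ = a`
    have hfin0 : ∑' n, ‖a n‖ₑ ^ 2 < ∞ :=
      lt_of_le_of_lt (ENNReal.tsum_le_tsum fun n =>
        le_mul_of_one_le_left zero_le (one_le_ofReal_sobolevWeight_natCast_sq k n)) hfin
    have hsum : Summable fun n => ‖a n‖ ^ 2 := by
      simpa using ENNReal.summable_toReal hfin0.ne
    obtain ⟨g, hg2, hgc⟩ := exists_memLp_two_forall_mFourierCoeff_eq_of_summable hsum
    have hgi : Integrable g volume := hg2.integrable one_le_two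
    refine ⟨g, hasWeakPartialDeriv_of_forall_mFourierCoeff_eq hf.1 hgi ?_, hgi, ?_⟩
    · intro n
      rw [hgc n]
    · rw [eSobolevNorm_lt_top_iff]
      simp_rw [hgc]
      exact hfin
  · -- the coefficients of the weak derivatives are `2πi nᵢ f̂(n)`; sum the weights
    rintro ⟨hfk, hg⟩
    choose g hg using hg
    refine ⟨hfk.1, ?_⟩
    have hcoeff : ∀ i n, mFourierCoeff (g i) n =
        (2 * Real.pi * Complex.I * (n i)) • mFourierCoeff f n := fun i n =>
      mFourierCoeff_eq_of_hasWeakPartialDeriv hfk.1 (hg i).2.1 (hg i).1 n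
    -- `⟨n⟩^{2k} nᵢ² ‖f̂(n)‖² ≤ ⟨n⟩^{2k} ‖ĝᵢ(n)‖²` (`1 ≤ 4π²`)
    have hterm : ∀ n i, ENNReal.ofReal (sobolevWeight (k : ℝ) n ^ 2) *
        ENNReal.ofReal ((n i : ℝ) ^ 2) * ‖mFourierCoeff f n‖ₑ ^ 2 ≤
        ENNReal.ofReal (sobolevWeight (k : ℝ) n ^ 2) * ‖mFourierCoeff (g i) n‖ₑ ^ 2 := by
      intro n i
      rw [hcoeff i n, enorm_sq_two_pi_I_mul_smul]
      calc ENNReal.ofReal (sobolevWeight (k : ℝ) n ^ 2) * ENNReal.ofReal ((n i : ℝ) ^ 2) *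
            ‖mFourierCoeff f n‖ₑ ^ 2
          = ENNReal.ofReal (sobolevWeight (k : ℝ) n ^ 2) *
            (1 * ENNReal.ofReal ((n i : ℝ) ^ 2) * ‖mFourierCoeff f n‖ₑ ^ 2) := by ring
        _ ≤ ENNReal.ofReal (sobolevWeight (k : ℝ) n ^ 2) *
            (ENNReal.ofReal (4 * Real.pi ^ 2) * ENNReal.ofReal ((n i : ℝ) ^ 2) *
              ‖mFourierCoeff f n‖ₑ ^ 2) := by
          gcongr
          exact ENNReal.one_le_ofReal.2 (by nlinarith [Real.two_le_pi])  -- `1 ≤ 4π²`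
    -- `⟨n⟩^{2(k+1)} ‖f̂(n)‖² ≤ ⟨n⟩^{2k} ‖f̂(n)‖² + ∑ᵢ ⟨n⟩^{2k} ‖ĝᵢ(n)‖²`
    have hle : ∀ n, ENNReal.ofReal (sobolevWeight ((k : ℝ) + 1) n ^ 2) * ‖mFourierCoeff f n‖ₑ ^ 2 ≤
        ENNReal.ofReal (sobolevWeight (k : ℝ) n ^ 2) * ‖mFourierCoeff f n‖ₑ ^ 2 +
          ∑ i, ENNReal.ofReal (sobolevWeight (k : ℝ) n ^ 2) * ‖mFourierCoeff (g i) n‖ₑ ^ 2 := by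
      intro n
      calc
        ENNReal.ofReal (sobolevWeight ((k : ℝ) + 1) n ^ 2) * ‖mFourierCoeff f n‖ₑ ^ 2
          = ENNReal.ofReal (sobolevWeight (k : ℝ) n ^ 2) * ‖mFourierCoeff f n‖ₑ ^ 2 +
            ∑ i, ENNReal.ofReal (sobolevWeight (k : ℝ) n ^ 2) * ENNReal.ofReal ((n i : ℝ) ^ 2) *
              ‖mFourierCoeff f n‖ₑ ^ 2 := by
            rw [ofReal_sobolevWeight_natCast_succ_sq, mul_add, mul_one, add_mul, Finset.mul_sum,
              Finset.sum_mul]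
        _ ≤ _ := add_le_add le_rfl (Finset.sum_le_sum fun i _ => hterm n i)
    -- sum over `n`: `‖f‖²_{H^{k+1}} ≤ ‖f‖²_{H^k} + ∑ᵢ ‖gᵢ‖²_{H^k} < ∞`
    rw [eSobolevNorm_lt_top_iff]
    refine lt_of_le_of_lt (ENNReal.tsum_le_tsum hle) ?_
    rw [ENNReal.tsum_add, Summable.tsum_finsetSum fun _ _ => ENNReal.summable]
    exact ENNReal.add_lt_top.2 ⟨eSobolevNorm_lt_top_iff.1 hfk.2,
      ENNReal.sum_lt_top.2 fun i _ => eSobolevNorm_lt_top_iff.1 (hg i).2.2⟩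

end Main

end Torus

end Literature.Analysis.FunctionSpaces
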